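import Mathlib
import Literature.NumberTheory.LFunctions.Zhang2022.TypedSection16ACalM2
import Literature.NumberTheory.LFunctions.Zhang2022.AppendixALemma161Steps
import HarnessLib

/-!
# Zhang (2022) §16 p. 91: the Euler factors of `ℳ₂(d,l;s)` — `1 + O(q^{−1−σ})` for `q ∤ dl`,
# `1 + O(q^{−σ})` for every prime, holomorphic on `σ > 9/10` (local inputs of §16.u021/u022)

Topic `Literature/NumberTheory/LFunctions/Zhang2022` (Landau–Siegel audit tree; verdict-neutral).
Y. Zhang, *Discrete mean estimates and the Landau–Siegel zero*, arXiv:2211.02515v1 (2022)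
[Zhang2022LandauSiegel] — **an unrefereed manuscript under adjudication; nothing in this file asserts
or denies its Theorems 1–2.** §16 p. 91 (tex L4537–L4541), DAG nodes `Z22:§16.u021` (analytic part)
and `Z22:§16.u022`:

> It can be verified, for `σ > 9/10`, that the function `ℳ₂(d,l;s) := ζ(s)L(s,χ)ζ(s+β₁)⁻¹ Σ_n λ̃₂(n,d)
> ξ₂(n;d,l)n^{−s}` is analytic and it satisfies `ℳ₂(d,l;s) ≪ ∏_{q∣dl}(1 + cq^{−9/10})`.

The typed object `Typed.Section16A.calM2 c′ χ d l s` is the Euler product `∏'_q calM2Factor` of the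
local factors `F_q(s) = (1−q^{−s−β₁})/((1−q^{−s})(1−χ(q)q^{−s})) · (1 + λ̃₂(q,d)Σ_{r≥1}ξ₂(qʳ;d,l)q^{−rs})`
(§16 p. 91 / p. 92 u026). This file proves the LOCAL facts the verification needs, for EVERY modulus
`D`, character `χ`, prime `q` and all `d, l` (no largeness, no Assumption (A)):

* `xi2_prime_pow_eq_one_one_of_coprime`, `calM2Factor_eq_one_one_of_coprime` — for `q ∤ dl` the local
  data of `(d,l)` are those of `(1,1)`: `ξ₂(qʳ;d,l) = ξ₂(qʳ;1,1)`, `λ̃₂(q,d) = λ₂(q)`, hence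
  `F_q^{(d,l)} = F_q^{(1,1)}` (App. A p. 105: `κ̃₂(qʳ;d)`, `ξ₂(qʳ;d,l)` depend on `d, l` only through
  `q ∣ d`, `q ∣ l`; tree `AppendixA.kappaTilde2_prime_pow_succ`, `AppendixA.xi2_prime_pow`);
* `norm_calM2Factor_sub_one_le_of_coprime` — **`‖F_q(s) − 1‖ ≤ 225·q^{−σ}/q`** for `q ∤ dl`,
  `σ ≥ 9/10`: the tree's closed form `AppendixA.calM2Factor_prime_one_one` (`F_q^{(1,1)} = locF`) and
  its estimate `AppendixA.norm_locF_sub_one_le` (the manuscript's "`1 + O(q^{−19/10})`", here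
  `O(q^{−1−σ})`);
* `norm_calM2Factor_sub_one_le` — **`‖F_q(s) − 1‖ ≤ 900·q^{−σ}`** for EVERY prime `q`, all `d, l`,
  `σ ≥ 9/10` (the "trivial" bound at the primes `q ∣ dl`): prefactor `= 1 + O(q^{−σ})`, and the local
  series in the closed form of `AppendixA.xi2LocalSeries_prime` is `O(q^{−σ})`;
* `norm_xi2_prime_pow_le` (`|ξ₂(qʳ;d,l)| ≤ (r+1)⁴`, from `Section16ACalM2.norm_xi2_le`),
  `differentiableOn_xi2LocalSeries`, **`differentiableOn_calM2Factor`** — each local factor is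
  holomorphic on `σ > 9/10` (normally convergent `r`-series; the denominators do not vanish).

The sequel `Section16ACalM2Analytic` assembles these into the nodes `Step16_u021an` / `Step16_u022`
(product of holomorphic factors close to `1`). Theorems only: no definition, no claim node, no named
fact; axioms standard. WHAT THIS IS NOT: anything about (16.10)/(16.12), Theorems 1–2 of the source, or
Landau–Siegel zeros.

## References

* Y. Zhang, arXiv:2211.02515v1 (2022), §16 p. 91 (u021, u022), p. 92 (u026); Appendix A p. 105.
  [cite: Zhang2022LandauSiegel, §16 p. 91]
-/

noncomputable section

open Complex Real Filter Topology
open Literature.NumberTheory.LFunctions.Zhang2022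
open Literature.NumberTheory.LFunctions.Zhang2022.Skeleton

namespace Literature.NumberTheory.LFunctions.Zhang2022.Typed.Section16A

/-! ## §1. For `q ∤ dl` the local factor is that of `(d,l) = (1,1)` -/

section Coprime

variable (c' : ℝ) {D : ℕ} (χ : DirichletCharacter ℂ D)

/-- **`ξ₂(qʳ;d,l) = ξ₂(qʳ;1,1)` for `q ∤ dl`** (`q` prime, `r ≥ 1`): by u033 of App. A
(`AppendixA.xi2_prime_pow`) both equal `κ̃₂(qʳ;·) − χ(q)q(q−1)⁻¹κ₂(q^{r−1})`, and
`κ̃₂(qʳ;d) = κ̃₂(qʳ;1) = wʳ⁻¹(w−1)/(1 − wχ(q)/q)` for `(q,d) = 1` (`AppendixA.kappaTilde2_prime_pow_succ`).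
[cite: Zhang2022LandauSiegel, App. A p. 105] -/
theorem xi2_prime_pow_eq_one_one_of_coprime {q : ℕ} (hq : q.Prime) {d l : ℕ}
    (hd : Nat.Coprime q d) (hl : Nat.Coprime q l) {r : ℕ} (hr : 1 ≤ r) :
    xi2 c' χ (q ^ r) d l = xi2 c' χ (q ^ r) 1 1 := by
  obtain ⟨r, rfl⟩ : ∃ r', r = r' + 1 := ⟨r - 1, by omega⟩
  rw [AppendixA.xi2_prime_pow c' χ d l hq hr, AppendixA.xi2_prime_pow c' χ 1 1 hq hr, if_pos hl,
    if_pos (Nat.coprime_one_right q), AppendixA.kappaTilde2_prime_pow_succ c' χ hq r d,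
    AppendixA.kappaTilde2_prime_pow_succ c' χ hq r 1, if_pos hd, if_pos (Nat.coprime_one_right q)]

/-- **The local series at `q ∤ dl` is that of `(1,1)`**: `Σ_{r≥1}ξ₂(qʳ;d,l)q^{−rs} = Σ_{r≥1}ξ₂(qʳ;1,1)q^{−rs}`
(termwise, every `s`). [cite: Zhang2022LandauSiegel, App. A p. 105] -/
theorem xi2LocalSeries_eq_one_one_of_coprime {q : ℕ} (hq : q.Prime) {d l : ℕ}
    (hd : Nat.Coprime q d) (hl : Nat.Coprime q l) (s : ℂ) :
    xi2LocalSeries c' χ q d l s = xi2LocalSeries c' χ q 1 1 s := by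
  unfold xi2LocalSeries
  refine tsum_congr fun r => ?_
  split_ifs with hr
  · rfl
  · rw [xi2_prime_pow_eq_one_one_of_coprime c' χ hq hd hl (Nat.one_le_iff_ne_zero.mpr hr)]

/-- **`λ̃₂(q,d) = λ̃₂(q,1) = λ₂(q)` for `(q,d) = 1`** ((16.8) at a prime).
[cite: Zhang2022LandauSiegel, §16 (16.8) p. 91] -/
theorem lamTilde2_prime_eq_one_of_coprime {q : ℕ} (hq : q.Prime) {d : ℕ} (hd : Nat.Coprime q d) :
    lamTilde2 c' χ q d = lamTilde2 c' χ q 1 := by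
  rw [AppendixA.lamTilde2_prime c' χ hq d, AppendixA.lamTilde2_prime c' χ hq 1, if_pos hd,
    if_pos (Nat.coprime_one_right q)]

/-- **For `q ∤ dl` the Euler factor of `ℳ₂(d,l;s)` at `q` is the Euler factor of `ℳ₂(1,1;s)`**: the
local data `κ̃₂(qʳ;d)`, `ξ₂(qʳ;d,l)`, `λ̃₂(q,d)` depend on `(d,l)` only through `q ∣ d`, `q ∣ l`
(App. A p. 105). [cite: Zhang2022LandauSiegel, §16 p. 91, App. A p. 105] -/
theorem calM2Factor_eq_one_one_of_coprime {q : ℕ} (hq : q.Prime) {d l : ℕ}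
    (hqdl : Nat.Coprime q (d * l)) (s : ℂ) :
    calM2Factor c' χ q d l s = calM2Factor c' χ q 1 1 s := by
  have hd : Nat.Coprime q d := Nat.Coprime.coprime_dvd_right (dvd_mul_right d l) hqdl
  have hl : Nat.Coprime q l := Nat.Coprime.coprime_dvd_right (dvd_mul_left l d) hqdl
  unfold calM2Factor
  rw [xi2LocalSeries_eq_one_one_of_coprime c' χ hq hd hl, lamTilde2_prime_eq_one_of_coprime c' χ hq hd]

end Coprime

/-! ## §2. The two local estimates -/

section Estimates

variable (c' : ℝ) {D : ℕ} (χ : DirichletCharacter ℂ D)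

/-- `Re β₁ = 0`, so `‖q^{−(s+β₁)}‖ = ‖q^{−s}‖ = q^{−σ}`. [cite: Zhang2022LandauSiegel, §2 (2.13)] -/
theorem norm_cpow_neg_add_beta1 {q : ℕ} (hq : 0 < q) (s : ℂ) :
    ‖(q : ℂ) ^ (-(s + beta1 c' D))‖ = (q : ℝ) ^ (-s.re) := by
  rw [Complex.norm_natCast_cpow_of_pos hq, Complex.neg_re, Complex.add_re, beta1_eq_b1_mul_I]
  simp

/-- **The Euler factor at a prime `q ∤ dl` is `1 + O(q^{−1−σ})`**: for `σ ≥ 9/10`,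
`‖F_q(s) − 1‖ ≤ 225·q^{−σ}/q` (the manuscript's "`= 1 + O(q^{−19/10})` for `σ > 9/10`", §16 p. 91;
via `calM2Factor_eq_one_one_of_coprime`, the closed form `AppendixA.calM2Factor_prime_one_one` and
`AppendixA.norm_locF_sub_one_le`). [cite: Zhang2022LandauSiegel, §16 p. 91] -/
theorem norm_calM2Factor_sub_one_le_of_coprime {q : ℕ} (hq : q.Prime) {d l : ℕ}
    (hqdl : Nat.Coprime q (d * l)) {s : ℂ} (hs : 9 / 10 ≤ s.re) :
    ‖calM2Factor c' χ q d l s - 1‖ ≤ 225 * (q : ℝ) ^ (-s.re) / q := by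
  obtain ⟨ex, hx⟩ := AppendixA.norm_cpow_neg_le_three_fifths hq.two_le hs
  have hx1 : ‖(q : ℂ) ^ (-s)‖ < 1 := by linarith
  obtain ⟨hw, -⟩ := AppendixA.norm_cpow_neg_beta1 c' (D := D) hq.pos
  have hv : ‖χ (q : ZMod D)‖ ≤ 1 := DirichletCharacter.norm_le_one χ _
  rw [calM2Factor_eq_one_one_of_coprime c' χ hq hqdl s,
    AppendixA.calM2Factor_prime_one_one c' χ hq s hx1]
  calc ‖AppendixA.locF (χ (q : ZMod D)) ((q : ℂ) ^ (-beta1 c' D)) ((q : ℂ) ^ (-s)) q - 1‖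
      ≤ 225 * ‖(q : ℂ) ^ (-s)‖ / q := AppendixA.norm_locF_sub_one_le hv hw.le hx hq.two_le
    _ = 225 * (q : ℝ) ^ (-s.re) / q := by rw [ex]

/-- `‖1 − y‖ ≥ 2/5` for `‖y‖ ≤ 3/5`, and `‖1 − y‖ ≥ 1/2` for `‖y‖ ≤ 1/2`. [folklore] -/
private theorem norm_one_sub_ge {y : ℂ} {θ : ℝ} (hy : ‖y‖ ≤ θ) : 1 - θ ≤ ‖1 - y‖ := by
  have := norm_sub_norm_le (1 : ℂ) y
  rw [norm_one] at this
  linarith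

/-- **The Euler factor at ANY prime is `1 + O(q^{−σ})`**: for `σ ≥ 9/10`, every prime `q` and all
`d, l`, `‖F_q(s) − 1‖ ≤ 900·q^{−σ}` (§16 p. 91; App. A p. 105 for the closed form of the local series,
`AppendixA.xi2LocalSeries_prime`): with `x = q^{−s}` (`‖x‖ ≤ 3/5`), `w = q^{−β₁}` (unimodular),
`v = χ(q)`, the prefactor `(1−wx)/((1−x)(1−vx))` is within `25‖x‖` of `1`, `|λ̃₂(q,d)| ≤ 3`, and the
local series `c_d(w−1)x/(1−wx) − [q∤l]χ(q)q(q−1)⁻¹x(1−x)/(1−wx)` has norm `≤ 18‖x‖`.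
[cite: Zhang2022LandauSiegel, §16 p. 91] -/
theorem norm_calM2Factor_sub_one_le [NeZero D] {q : ℕ} (hq : q.Prime) (d l : ℕ) {s : ℂ}
    (hs : 9 / 10 ≤ s.re) :
    ‖calM2Factor c' χ q d l s - 1‖ ≤ 900 * (q : ℝ) ^ (-s.re) := by
  obtain ⟨ex, hx⟩ := AppendixA.norm_cpow_neg_le_three_fifths hq.two_le hs
  have hx1 : ‖(q : ℂ) ^ (-s)‖ < 1 := by linarith
  obtain ⟨hw, -⟩ := AppendixA.norm_cpow_neg_beta1 c' (D := D) hq.pos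
  have hv : ‖χ (q : ZMod D)‖ ≤ 1 := DirichletCharacter.norm_le_one χ _
  have hq2 : (2 : ℝ) ≤ q := by exact_mod_cast hq.two_le
  have hq0 : (0 : ℝ) < q := by linarith
  have hqC : (q : ℂ) ≠ 0 := by exact_mod_cast hq.ne_zero
  set x : ℂ := (q : ℂ) ^ (-s) with hxdef
  set w : ℂ := (q : ℂ) ^ (-beta1 c' D) with hwdef
  set v : ℂ := χ (q : ZMod D) with hvdef
  set t : ℝ := ‖x‖ with ht
  have ht0 : 0 ≤ t := norm_nonneg _
  have ht35 : t ≤ 3 / 5 := hx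
  -- the prefactor `P = (1 − wx)/((1−x)(1−vx))`
  have hax : (q : ℂ) ^ (-(s + beta1 c' D)) = w * x := by
    rw [neg_add, Complex.cpow_add _ _ hqC, mul_comm]
  have hwx : ‖w * x‖ ≤ 3 / 5 := by rw [norm_mul, hw, one_mul]; exact ht35
  have hvx : ‖v * x‖ ≤ 3 / 5 := by
    rw [norm_mul]
    calc ‖v‖ * ‖x‖ ≤ 1 * (3 / 5) := by gcongr
      _ = 3 / 5 := one_mul _
  have hd1 : 2 / 5 ≤ ‖1 - x‖ := by have := norm_one_sub_ge ht35; linarith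
  have hd2 : 2 / 5 ≤ ‖1 - v * x‖ := by have := norm_one_sub_ge hvx; linarith
  have hd3 : 2 / 5 ≤ ‖1 - w * x‖ := by have := norm_one_sub_ge hwx; linarith
  have hden : 4 / 25 ≤ ‖(1 - x) * (1 - v * x)‖ := by
    rw [norm_mul]; nlinarith
  have hden0 : (1 - x) * (1 - v * x) ≠ 0 := by
    intro h; rw [h, norm_zero] at hden; linarith
  set P : ℂ := (1 - w * x) / ((1 - x) * (1 - v * x)) with hP
  have hP1 : ‖P - 1‖ ≤ 25 * t := by
    rw [hP, div_sub_one hden0, norm_div, div_le_iff₀ (by linarith)]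
    have e : 1 - w * x - (1 - x) * (1 - v * x) = -(w * x) + x + v * x + -(v * x * x) := by ring
    rw [e]
    have h1 : ‖-(w * x)‖ ≤ t := by rw [norm_neg, norm_mul, hw, one_mul, ht]
    have h2 : ‖x‖ ≤ t := le_of_eq ht.symm
    have h3 : ‖v * x‖ ≤ t := by
      rw [norm_mul]
      calc ‖v‖ * ‖x‖ ≤ 1 * ‖x‖ := by gcongr
        _ = t := by rw [one_mul]
    have h4 : ‖-(v * x * x)‖ ≤ t := by
      rw [norm_neg, norm_mul]
      calc ‖v * x‖ * ‖x‖ ≤ (3 / 5) * t := by gcongr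
        _ ≤ t := by linarith
    calc ‖-(w * x) + x + v * x + -(v * x * x)‖
        ≤ ‖-(w * x)‖ + ‖x‖ + ‖v * x‖ + ‖-(v * x * x)‖ := by
          refine (norm_add_le _ _).trans ?_
          gcongr
          refine (norm_add_le _ _).trans ?_
          gcongr
          exact norm_add_le _ _
      _ ≤ t + t + t + t := by gcongr
      _ = 4 * t := by ring
      _ ≤ 25 * t * ‖(1 - x) * (1 - v * x)‖ := by nlinarith
  -- `|λ̃₂(q,d)| ≤ 3`
  have hlam : ‖lamTilde2 c' χ q d‖ ≤ 3 := by
    have h := Section16ACalM2.norm_lamTilde2_le_three_pow c' χ q d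
    rwa [hq.primeFactors, Finset.card_singleton, pow_one] at h
  -- the local series in closed form, `‖S‖ ≤ 18 t`
  have hS : ‖xi2LocalSeries c' χ q d l s‖ ≤ 18 * t := by
    rw [AppendixA.xi2LocalSeries_prime c' χ hq d l s hx1]
    have hq1 : (q : ℝ) - 1 = ‖(q : ℂ) - 1‖ := by
      have : (q : ℂ) - 1 = (((q : ℝ) - 1 : ℝ) : ℂ) := by push_cast; ring
      rw [this, Complex.norm_real, Real.norm_eq_abs, abs_of_nonneg (by linarith)]
    -- `‖c_d‖ ≤ 2`
    have hcd : ‖(if Nat.Coprime q d then (1 - w * (v / q))⁻¹ else (1 : ℂ))‖ ≤ 2 := by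
      split_ifs
      · have hy : ‖w * (v / q)‖ ≤ 1 / 2 := by
          rw [norm_mul, hw, one_mul, norm_div, Complex.norm_natCast, div_le_iff₀ hq0]
          nlinarith
        have h12 : 1 / 2 ≤ ‖1 - w * (v / q)‖ := by
          have h' := norm_one_sub_ge hy
          linarith
        rw [norm_inv]
        calc ‖1 - w * (v / q)‖⁻¹ ≤ (1 / 2 : ℝ)⁻¹ := inv_anti₀ (by norm_num) h12
          _ = 2 := by norm_num
      · rw [norm_one]; norm_num
    have hil : ‖(if Nat.Coprime q l then (1 : ℂ) else 0)‖ ≤ 1 := by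
      split_ifs <;> simp
    have hw1 : ‖w - 1‖ ≤ 2 := by
      calc ‖w - 1‖ ≤ ‖w‖ + ‖(1 : ℂ)‖ := norm_sub_le _ _
        _ = 2 := by rw [hw, norm_one]; norm_num
    have hvq : ‖v * q / ((q : ℂ) - 1)‖ ≤ 2 := by
      rw [norm_div, norm_mul, Complex.norm_natCast, ← hq1, div_le_iff₀ (by linarith)]
      nlinarith [norm_nonneg v]
    have hfrac1 : ‖x / (1 - w * x)‖ ≤ 5 / 2 * t := by
      rw [norm_div, div_le_iff₀ (by linarith)]
      nlinarith [mul_le_mul_of_nonneg_left hd3 ht0, ht]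
    have hfrac2 : ‖x * (1 - x) / (1 - w * x)‖ ≤ 4 * t := by
      rw [norm_div, div_le_iff₀ (by linarith), norm_mul]
      have h1x : ‖1 - x‖ ≤ 8 / 5 := by
        calc ‖1 - x‖ ≤ ‖(1 : ℂ)‖ + ‖x‖ := norm_sub_le _ _
          _ ≤ 1 + 3 / 5 := by rw [norm_one]; gcongr
          _ = 8 / 5 := by norm_num
      calc ‖x‖ * ‖1 - x‖ = t * ‖1 - x‖ := by rw [ht]
        _ ≤ t * (8 / 5) := by gcongr
        _ ≤ 4 * t * ‖1 - w * x‖ := by nlinarith [mul_le_mul_of_nonneg_left hd3 ht0]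
    have hA : ‖(if Nat.Coprime q d then (1 - w * (v / q))⁻¹ else (1 : ℂ)) * (w - 1) * x /
        (1 - w * x)‖ ≤ 10 * t := by
      rw [mul_div_assoc, norm_mul, norm_mul]
      calc ‖(if Nat.Coprime q d then (1 - w * (v / q))⁻¹ else (1 : ℂ))‖ * ‖w - 1‖ *
            ‖x / (1 - w * x)‖ ≤ 2 * 2 * (5 / 2 * t) := by
            gcongr
        _ = 10 * t := by ring
    have hB : ‖(if Nat.Coprime q l then (1 : ℂ) else 0) * (v * q / ((q : ℂ) - 1)) *
        (x * (1 - x) / (1 - w * x))‖ ≤ 8 * t := by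
      rw [norm_mul, norm_mul]
      calc ‖(if Nat.Coprime q l then (1 : ℂ) else 0)‖ * ‖v * q / ((q : ℂ) - 1)‖ *
            ‖x * (1 - x) / (1 - w * x)‖ ≤ 1 * 2 * (4 * t) := by
            gcongr
        _ = 8 * t := by ring
    show ‖(if Nat.Coprime q d then (1 - w * (v / q))⁻¹ else (1 : ℂ)) * (w - 1) * x / (1 - w * x) -
        (if Nat.Coprime q l then (1 : ℂ) else 0) * (v * q / ((q : ℂ) - 1)) *
          (x * (1 - x) / (1 - w * x))‖ ≤ 18 * t
    calc _ ≤ ‖(if Nat.Coprime q d then (1 - w * (v / q))⁻¹ else (1 : ℂ)) * (w - 1) * x /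
              (1 - w * x)‖ +
            ‖(if Nat.Coprime q l then (1 : ℂ) else 0) * (v * q / ((q : ℂ) - 1)) *
              (x * (1 - x) / (1 - w * x))‖ := norm_sub_le _ _
      _ ≤ 10 * t + 8 * t := add_le_add hA hB
      _ = 18 * t := by ring
  -- the second factor `E = λ̃₂·S`, `‖E‖ ≤ 54 t`
  set E : ℂ := lamTilde2 c' χ q d * xi2LocalSeries c' χ q d l s with hE
  have hEn : ‖E‖ ≤ 54 * t := by
    rw [hE, norm_mul]
    calc ‖lamTilde2 c' χ q d‖ * ‖xi2LocalSeries c' χ q d l s‖ ≤ 3 * (18 * t) := by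
          gcongr
      _ = 54 * t := by ring
  -- assemble: `F − 1 = (P − 1)(1 + E) + E`
  have hfac : calM2Factor c' χ q d l s = P * (1 + E) := by
    simp only [calM2Factor, hP, hE, hax, hxdef, hvdef, hwdef]
  rw [hfac]
  have e : P * (1 + E) - 1 = (P - 1) * (1 + E) + E := by ring
  rw [e]
  have h1E : ‖1 + E‖ ≤ 1 + 54 * t := by
    calc ‖1 + E‖ ≤ ‖(1 : ℂ)‖ + ‖E‖ := norm_add_le _ _
      _ ≤ 1 + 54 * t := by rw [norm_one]; gcongr
  calc ‖(P - 1) * (1 + E) + E‖ ≤ ‖(P - 1) * (1 + E)‖ + ‖E‖ := norm_add_le _ _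
    _ = ‖P - 1‖ * ‖1 + E‖ + ‖E‖ := by rw [norm_mul]
    _ ≤ 25 * t * (1 + 54 * t) + 54 * t := by gcongr
    _ ≤ 900 * t := by nlinarith
    _ = 900 * (q : ℝ) ^ (-s.re) := by rw [ex]

end Estimates

/-! ## §3. Holomorphy of the local factors on `σ > 9/10` -/

section Holomorphy

variable (c' : ℝ) {D : ℕ} [NeZero D] (χ : DirichletCharacter ℂ D)

/-- The half-plane `σ > 9/10` is open. [folklore] -/
private theorem isOpen_U : IsOpen {s : ℂ | 9 / 10 < s.re} :=
  isOpen_lt continuous_const Complex.continuous_re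

/-- **`|ξ₂(qʳ;d,l)| ≤ (r+1)⁴`** for a prime `q` (`|ξ₂(n;d,l)| ≤ τ(n)⁴`, `Section16ACalM2.norm_xi2_le`,
and `τ(qʳ) = r + 1`). [cite: Zhang2022LandauSiegel, §16 (16.7) p. 91] -/
theorem norm_xi2_prime_pow_le {q : ℕ} (hq : q.Prime) (d l r : ℕ) :
    ‖xi2 c' χ (q ^ r) d l‖ ≤ ((r : ℝ) + 1) ^ 4 := by
  have h := Section16ACalM2.norm_xi2_le c' χ (pow_ne_zero r hq.ne_zero) d l
  rw [Nat.divisors_prime_pow hq r, Finset.card_map, Finset.card_range] at h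
  push_cast at h
  exact h

/-- **The local series `Σ_{r≥1} ξ₂(qʳ;d,l)q^{−rs}` is holomorphic on `σ > 9/10`** (normally
convergent: `|ξ₂(qʳ)q^{−rs}| ≤ (r+1)⁴q^{−9r/10}`). [cite: Zhang2022LandauSiegel, §16 p. 91] -/
theorem differentiableOn_xi2LocalSeries {q : ℕ} (hq : q.Prime) (d l : ℕ) :
    DifferentiableOn ℂ (xi2LocalSeries c' χ q d l) {s : ℂ | 9 / 10 < s.re} := by
  classical
  have hq0 : (0 : ℝ) < q := by exact_mod_cast hq.pos
  have hq1 : (1 : ℝ) ≤ q := by exact_mod_cast hq.one_lt.le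
  have hqC : (q : ℂ) ≠ 0 := by exact_mod_cast hq.ne_zero
  set ρ : ℝ := (q : ℝ) ^ (-(9 / 10 : ℝ)) with hρ
  have hρ0 : 0 ≤ ρ := Real.rpow_nonneg hq0.le _
  have hρ1 : ρ < 1 := Real.rpow_lt_one_of_one_lt_of_neg (by exact_mod_cast hq.one_lt) (by norm_num)
  -- the summands and their majorant
  set F : ℕ → ℂ → ℂ := fun r s =>
    if r = 0 then 0 else xi2 c' χ (q ^ r) d l / (q : ℂ) ^ ((r : ℂ) * s) with hF
  set u : ℕ → ℝ := fun r => ((r : ℝ) + 1) ^ 4 * ρ ^ r with hu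
  have hu_sum : Summable u := by
    have h : Summable (fun n : ℕ => (n : ℝ) ^ 4 * ρ ^ n) :=
      summable_pow_mul_geometric_of_norm_lt_one 4 (by rw [Real.norm_eq_abs, abs_of_nonneg hρ0]; exact hρ1)
    have h2 : Summable (fun n : ℕ => (((n + 1 : ℕ) : ℝ)) ^ 4 * ρ ^ (n + 1)) :=
      (summable_nat_add_iff 1).mpr h
    have h3 : Summable (fun n : ℕ => ((n : ℝ) + 1) ^ 4 * ρ ^ n * ρ) := by
      refine h2.congr fun n => ?_
      push_cast; ring
    rcases eq_or_lt_of_le hρ0 with hρz | hρpos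
    · refine summable_of_ne_finset_zero (s := {0}) fun r hr => ?_
      have hr0 : r ≠ 0 := by simpa using hr
      simp [hu, ← hρz, zero_pow hr0]
    · have hρne : ρ ≠ 0 := hρpos.ne'
      refine (h3.mul_right ρ⁻¹).congr fun n => ?_
      simp only [hu, mul_inv_cancel_right₀ hρne]
  have hF_diff : ∀ r, DifferentiableOn ℂ (F r) {s : ℂ | 9 / 10 < s.re} := by
    intro r
    simp only [hF]
    split_ifs
    · exact differentiableOn_const _
    · refine DifferentiableOn.div (differentiableOn_const _) ?_ fun s _ => ?_
      · intro s _
        exact ((differentiableAt_id.const_mul (r : ℂ)).const_cpow (Or.inl hqC)).differentiableWithinAt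
      · exact fun h => hqC (Complex.cpow_eq_zero_iff _ _ |>.mp h).1
  have hF_le : ∀ (r : ℕ) (s : ℂ), s ∈ {s : ℂ | 9 / 10 < s.re} → ‖F r s‖ ≤ u r := by
    intro r s hs
    have hs' : 9 / 10 < s.re := hs
    simp only [hF, hu]
    split_ifs with hr
    · rw [norm_zero]; positivity
    · have hden : ‖(q : ℂ) ^ ((r : ℂ) * s)‖ = (q : ℝ) ^ ((r : ℝ) * s.re) := by
        rw [Complex.norm_natCast_cpow_of_pos hq.pos]
        congr 1
        simp
      have hlow : (q : ℝ) ^ ((r : ℝ) * (9 / 10)) ≤ (q : ℝ) ^ ((r : ℝ) * s.re) :=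
        Real.rpow_le_rpow_of_exponent_le hq1 (by
          have : (0 : ℝ) ≤ r := Nat.cast_nonneg r
          nlinarith)
      have hpos : 0 < (q : ℝ) ^ ((r : ℝ) * (9 / 10)) := Real.rpow_pos_of_pos hq0 _
      have hρr : ρ ^ r = ((q : ℝ) ^ ((r : ℝ) * (9 / 10)))⁻¹ := by
        rw [hρ, ← Real.rpow_natCast, ← Real.rpow_mul hq0.le, ← Real.rpow_neg hq0.le]
        congr 1; ring
      rw [norm_div, hden]
      calc ‖xi2 c' χ (q ^ r) d l‖ / (q : ℝ) ^ ((r : ℝ) * s.re)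
          ≤ ((r : ℝ) + 1) ^ 4 / (q : ℝ) ^ ((r : ℝ) * (9 / 10)) := by
            gcongr
            exact norm_xi2_prime_pow_le c' χ hq d l r
        _ = ((r : ℝ) + 1) ^ 4 * ρ ^ r := by rw [hρr, div_eq_mul_inv]
  have key := differentiableOn_tsum_of_summable_norm hu_sum hF_diff isOpen_U hF_le
  have hfun : xi2LocalSeries c' χ q d l = fun s => ∑' r, F r s := by
    funext s; rfl
  rw [hfun]
  exact key

/-- For `‖z‖ < 1`, `‖w‖ ≤ 1`: `1 − wz ≠ 0`. [folklore] -/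
private theorem one_sub_ne_zero_of_norm_lt {z w : ℂ} (hw : ‖w‖ ≤ 1) (hz : ‖z‖ < 1) :
    1 - w * z ≠ 0 := by
  intro h
  have h1 : w * z = 1 := by linear_combination -h
  have : ‖w * z‖ < 1 := by
    rw [norm_mul]
    calc ‖w‖ * ‖z‖ ≤ 1 * ‖z‖ := by gcongr
      _ = ‖z‖ := one_mul _
      _ < 1 := hz
  rw [h1, norm_one] at this
  exact lt_irrefl _ this

/-- **Each Euler factor `calM2Factor q d l ·` of `ℳ₂(d,l;·)` is holomorphic on `σ > 9/10`** (the
denominators `(1 − q^{−s})(1 − χ(q)q^{−s})` do not vanish there). [cite: Zhang2022LandauSiegel, §16 p. 91] -/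
theorem differentiableOn_calM2Factor {q : ℕ} (hq : q.Prime) (d l : ℕ) :
    DifferentiableOn ℂ (fun s => calM2Factor c' χ q d l s) {s : ℂ | 9 / 10 < s.re} := by
  have hqC : (q : ℂ) ≠ 0 := by exact_mod_cast hq.ne_zero
  have hcpow : ∀ β : ℂ,
      DifferentiableOn ℂ (fun s : ℂ => (q : ℂ) ^ (-(s + β))) {s : ℂ | 9 / 10 < s.re} :=
    fun β s _ =>
      (((differentiableAt_id.add_const β).neg).const_cpow (Or.inl hqC)).differentiableWithinAt
  have hcpow0 : DifferentiableOn ℂ (fun s : ℂ => (q : ℂ) ^ (-s)) {s : ℂ | 9 / 10 < s.re} :=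
    fun s _ => ((differentiableAt_id.neg).const_cpow (Or.inl hqC)).differentiableWithinAt
  have hden : ∀ s ∈ {s : ℂ | 9 / 10 < s.re},
      (1 - (q : ℂ) ^ (-s)) * (1 - χ (q : ZMod D) * (q : ℂ) ^ (-s)) ≠ 0 := by
    intro s hs
    have hs' : 9 / 10 < s.re := hs
    have hz : ‖(q : ℂ) ^ (-s)‖ < 1 := by
      rw [Complex.norm_natCast_cpow_of_pos hq.pos, Complex.neg_re]
      exact Real.rpow_lt_one_of_one_lt_of_neg (by exact_mod_cast hq.one_lt) (by linarith)
    refine mul_ne_zero ?_ (one_sub_ne_zero_of_norm_lt (DirichletCharacter.norm_le_one χ _) hz)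
    have := one_sub_ne_zero_of_norm_lt (w := 1) (by simp) hz
    simpa using this
  unfold calM2Factor
  refine DifferentiableOn.mul (DifferentiableOn.div ?_ ?_ hden) ?_
  · exact (differentiableOn_const _).sub (hcpow _)
  · exact ((differentiableOn_const _).sub hcpow0).mul
      ((differentiableOn_const _).sub ((differentiableOn_const _).mul hcpow0))
  · exact (differentiableOn_const _).add
      ((differentiableOn_const _).mul (differentiableOn_xi2LocalSeries c' χ hq d l))

end Holomorphy

end Literature.NumberTheory.LFunctions.Zhang2022.Typed.Section16A
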